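import Mathlib.Analysis.InnerProductSpace.PiL2
import Mathlib.Analysis.Calculus.ContDiff.Defs
import Mathlib.MeasureTheory.Measure.Lebesgue.EqHaar
import Mathlib.MeasureTheory.Integral.Bochner.Set
import Mathlib.MeasureTheory.Measure.Haar.InnerProductSpace
import Mathlib.Analysis.SpecialFunctions.Pow.Real
import HarnessLib

/-!
# Propagation of smallness for real-analytic functions from measurable sets (Vessella; Apraiz–Escauriaza–Wang–Zhang)

A NAMED FACT (`def … : Prop`, not proved here) recording the interior observability / propagation-of-smallness inequality
for real-analytic functions from sets of positive measure:

> **Theorem 4** (J. Apraiz, L. Escauriaza, G. Wang, C. Zhang, *Observability inequalities and measurable sets*,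
> J. Eur. Math. Soc. 16 (2014) 2433–2475, Theorem 4 on p. 5 of arXiv:1202.4876; first established by S. Vessella,
> *A continuous dependence result in the analytic continuation problem*, Forum Math. 11 (1999) 695–703).
> Assume that `f : B_{2R} ⊂ ℝⁿ → ℝ` is real-analytic in `B_{2R}` verifying
> `|∂^α f(x)| ≤ M |α|! / (ρR)^{|α|}` for `x ∈ B_{2R}`, `α ∈ ℕⁿ`, for some `M > 0` and `0 < ρ ≤ 1`.  Let `E ⊂ B_R` be a
> measurable set with positive measure.  Then there are positive constants `N = N(ρ, |E|/|B_R|)` and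
> `θ = θ(ρ, |E|/|B_R|)` such that `‖f‖_{L^∞(B_R)} ≤ N (⨍_E |f| dx)^θ M^{1−θ}`.

## Statement as typed (`analyticPropagationOfSmallness n`), and why it is implied by the printed theorem

On `EuclideanSpace ℝ (Fin n)` with Lebesgue measure, in OPERATOR-NORM form and with the volume fraction as a parameter:
for `0 < ρ ≤ 1` and `0 < s ≤ 1` there are `N > 0` and `θ ∈ (0, 1]` such that for every `C^∞` function `f` (globally
smooth — stronger than the paper's hypothesis, costs nothing), every centre `x₀`, radius `R > 0` and `M > 0` with
`‖Dʲf(x)‖ ≤ M·j!/(ρR)ʲ` for all `j` and all `x ∈ B(x₀, 2R)` (the operator norm of `iteratedFDeriv` dominates every partial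
derivative `∂^α f`, `|α| = j`, so the paper's hypothesis holds with the same `M, ρ`; in particular `f` is real-analytic in
`B_{2R}`), and every measurable `E ⊆ B(x₀, R)` with `s·|B(x₀,R)| ≤ |E|`:
`|f(x)| ≤ N · ((∫_E |f|)/|E|)^θ · M^{1−θ}` for all `x ∈ B(x₀, R)`.
The dependence on the fraction is MONOTONE (constants valid for `|E|/|B_R| = s` serve all larger fractions: apply the
theorem to the sub-level portion `E' ⊆ E` of measure `s|B_R|` on which `|f|` is smallest, `⨍_{E'}|f| ≤ ⨍_E|f|`), whence the
`≥ s` form; and `θ ≤ 1` may be assumed (`⨍_E|f| ≤ M`, so lowering `θ` weakens the bound).  The pointwise conclusion on the open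
ball is weaker than the `L^∞(B_R)` bound.

USE IN THE TREE: hypothesis P-F of LINE g8-β «analytic gap» of crux `NearExtremalTransiencePerFlow`
(`Summits/NavierStokesRegularity/…/Cruxes/NearExtremalTransiencePerFlow/Lines/analytic_gap.lean`), whose workfile Prop
`AnalyticPropagationOfSmallness` is `analyticPropagationOfSmallness 3` verbatim.  Presearch: no propagation-of-smallness /
Remez-type / three-balls inequality for real-analytic functions exists in Mathlib or under `Literature/` (`lean search
'mallness'`, `'Remez'`, `'threeBall'`); the nearest tree items are the qualitative zero-set results
`Literature/Analysis/Calculus/RealAnalyticZeroSet*.lean`.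
-- TODO(general form): the paper allows `f` merely real-analytic on `B_{2R}` and states the `L^∞(B_R)` norm; a proof in the
-- tree would go through the Carleman/doubling route of Apraiz–Escauriaza (2013) or Vessella's original argument.
-/

noncomputable section

open MeasureTheory Metric

namespace Literature.Analysis.PDE

/-- **Propagation of smallness for real-analytic functions from measurable sets** (Apraiz–Escauriaza–Wang–Zhang 2014,
Theorem 4; Vessella 1999), on `ℝⁿ = EuclideanSpace ℝ (Fin n)`, operator-norm form with the volume fraction `s` as a
parameter: for `0 < ρ ≤ 1`, `0 < s ≤ 1` there are `N > 0`, `θ ∈ (0,1]` such that a `C^∞` function with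
`‖Dʲf‖ ≤ M·j!/(ρR)ʲ` on `B(x₀,2R)` (all `j`; `R, M > 0`) and a measurable `E ⊆ B(x₀,R)` with `s·|B(x₀,R)| ≤ |E|` satisfy
`|f(x)| ≤ N·((∫_E|f|)/|E|)^θ·M^{1−θ}` for every `x ∈ B(x₀,R)`.  A named fact, NOT proved in the tree.
[cite: ApraizEscauriazaWangZhang2014, Theorem 4 (arXiv p. 5)] -/
def analyticPropagationOfSmallness (n : ℕ) : Prop :=
  ∀ ρ s : ℝ, 0 < ρ → ρ ≤ 1 → 0 < s → s ≤ 1 →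
    ∃ Nc θ : ℝ, 0 < Nc ∧ 0 < θ ∧ θ ≤ 1 ∧
      ∀ (f : EuclideanSpace ℝ (Fin n) → ℝ) (x₀ : EuclideanSpace ℝ (Fin n)) (R M : ℝ), 0 < R → 0 < M →
        ContDiff ℝ (⊤ : ℕ∞) f →
        (∀ (j : ℕ) (x : EuclideanSpace ℝ (Fin n)), x ∈ Metric.ball x₀ (2 * R) →
            ‖iteratedFDeriv ℝ j f x‖ ≤ M * (j.factorial : ℝ) / (ρ * R) ^ j) →
        ∀ E : Set (EuclideanSpace ℝ (Fin n)), MeasurableSet E → E ⊆ Metric.ball x₀ R →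
          s * (volume (Metric.ball x₀ R)).toReal ≤ (volume E).toReal →
          ∀ x ∈ Metric.ball x₀ R,
            |f x| ≤ Nc * ((∫ y in E, |f y|) / (volume E).toReal) ^ θ * M ^ (1 - θ)

end Literature.Analysis.PDE

end
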